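import Summits.HodgeConjecture.HodgeConjecture.Theorems.H413E2SWBorelBoundFrame
import Literature.NumberTheory.Automorphic.DoubledUnitaryBorelDiag
import HarnessLib

/-!
# Crux H413, E-2 child line `F0_E2SiegelWeilWeilRange`, row SW2c-BOUND: the UNIPOTENT Borel translates lifted over the hom of record `j`
# — the binder `hLN` of the dilate-bound step (S-1) `Theorems/H413E2SWDilateBoundCM` (F0P4-p05 (g2))

HC_CM is proved only modulo the printed citations until rung 0 closes; nothing in this file is about HC.  Cell `hodgecm-mathlib`,
floor 0, programme P4, engine E-2, item stmt-HodgeConjecture-24833 (`--supports`); seat F0P4-p07 (g3); sheet `F0/P4/SW2c-BOUND-ASSEMBLY.v1`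
(8e2768b2) §B (J)/(L-N); sequel A5 of ★ `Theorems/H413E2SWBorelBoundFrame` (A4).

For every adele `β ∈ 𝔸_F` the unipotent element `u_β = M·n(δ·y)·M⁻¹ ∈ U_D = U(T_W ⊕ −T_W)(𝔸_F)` (`y = −2β/t`, `t = T_W 0 0`; ★ A-p16
`cayley_conj_upper_mem_adelic`) is a Borel element (row-sum condition) whose sum-model image `jS u_β` has Weil's unipotent shape
(★ `toSp_adelicInr_cayley_conj_upper_apply` through `hjS`), hence stabilises `W^Δ` (★ `mem_stabDiag_of_unipShape`); its frame lift
`q_β := u₀ · 𝐫₀ᶜᵒⁿᵗ(stabDiagParabolicFin ⟨jS u_β, _⟩) · u₀⁻¹` lies over `j u_β` (★ A4 `proj_frameLift_eq`), acts by the CHIRP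
`chirpLM (β • ratMatrix C₀)`, `C₀ = reindex (𝕋_F ⊕ −d 𝕋_F⁻¹)` the rational Gram matrix of the hermitian norm form (★ A-p12 (J-N)
`omega_conj_adelicSiegelLiftCont_of_unipShape` + the matrix identity `S_b = (½ b) • ratMatrix C₀` of this file), and is `L²`-isometric
(★ `l2Scaling_of_omega_eq_chirpLM_twistLM` at the trivial twist).  This is the hypothesis `hLN` of the (S-1) dilate-bound file VERBATIM at
`S := ratMatrix F C₀` (the `hhS` spelling of ★ `UnitaryDoubling.hNorm_eq_sdForm_C0`).

References: A. Weil, *Sur certains groupes d'opérateurs unitaires*, Acta Math. 111 (1964), Chap. I n° 13 p. 160 [Weil1964]; A. Weil, *Sur la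
formule de Siegel…*, Acta Math. 113 (1965), n° 46 p. 66, n° 47 Lemme 20 [Weil1965]; J.-S. Li, J. reine angew. Math. 428 (1992), p. 181 [Li1992].
-/


set_option autoImplicit false

noncomputable section

set_option linter.dupNamespace false

namespace Summit.HodgeConjecture.HodgeConjecture.Cruxes.H413.E2SWBorelBoundFrameUnip

open scoped NNReal ENNReal Matrix
open _root_.MeasureTheory NumberField IsDedekindDomain Matrix
open Literature.RepresentationTheory.HeisenbergGroup
open Literature.NumberTheory.Weil1964 Literature.NumberTheory.Weil1965 Literature.NumberTheory.Automorphic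
open Literature.NumberTheory.Automorphic.DoubledUnitary.RankOneReduction
open Literature.NumberTheory.Automorphic.UnitaryGroup
open Literature.NumberTheory.GelbartRogawski1991 Literature.NumberTheory.GelbartRogawski1991.UnitaryDualPair
open Summit.HodgeConjecture.HodgeConjecture.Cruxes.H413.E2SWBorelBoundFrame

variable (F E : Type) [Field F] [NumberField F] [Field E] [NumberField E] [Algebra F E] [Algebra.IsQuadraticExtension F E]
  (c : E ≃ₐ[F] E) {δ : E} (hcδ : c δ = -δ) (hδ : δ ≠ 0) {d : F} (hd : δ * δ = algebraMap F E d)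
  (N : ℕ) {n : ℕ} (e : Fin N × Fin 1 ≃ Fin n)
  {TV : Matrix (Fin N) (Fin N) F} (TW : Matrix (Fin 1) (Fin 1) F) (hV : TV.IsSymm)
  (hW2 : (Matrix.reindex finSumFinEquiv finSumFinEquiv (Matrix.fromBlocks TW 0 0 (-TW))).IsSymm)
  (hVd : IsUnit TV.det) (hWd : IsUnit TW.det)

/-- **Inverse and base change commute for an invertible rational matrix**: `(A⁻¹ ⊗ 1) = (A ⊗ 1)⁻¹` in `M(𝔸_F)`. [folklore] -/
theorem ratMatrix_inv {k : ℕ} (A : Matrix (Fin k) (Fin k) F) (hA : IsUnit A.det) :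
    ratMatrix F A⁻¹ = (ratMatrix F A)⁻¹ := by
  symm
  refine Matrix.inv_eq_left_inv ?_
  change (A⁻¹).map (algebraMap F (AdeleRing (𝓞 F) F)) * A.map (algebraMap F (AdeleRing (𝓞 F) F)) = 1
  rw [← Matrix.map_mul, Matrix.nonsing_inv_mul A hA, Matrix.map_one (algebraMap F (AdeleRing (𝓞 F) F)) (map_zero _) (map_one _)]

include hVd hWd in
/-- **The (L-N) chirp matrix is a scalar multiple of the frame Gram matrix**: `((½b)·𝕋 ⊕ −(½ d b)·𝕋⁻¹) = (½ b) • ratMatrix C₀`,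
`C₀ = reindex (𝕋_F ⊕ −d·𝕋_F⁻¹)`, `𝕋 = 𝕋_F ⊗ 1 = adelicGram`. [cite: Weil1965, n° 46 p. 66] -/
theorem unipChirpMatrix_eq_smul_ratMatrix_C0 (b : AdeleRing (𝓞 F) F) :
    Matrix.reindex finSumFinEquiv finSumFinEquiv
        (Matrix.fromBlocks ((⅟(2 : AdeleRing (𝓞 F) F) * b) • adelicGram F e TV TW) 0 0
          (-(((⅟(2 : AdeleRing (𝓞 F) F) * (algebraMap F (AdeleRing (𝓞 F) F) d * b)) • (adelicGram F e TV TW)⁻¹)))) =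
      (⅟(2 : AdeleRing (𝓞 F) F) * b) • ratMatrix F (Matrix.reindex finSumFinEquiv finSumFinEquiv
        (Matrix.fromBlocks (gram F e TV TW) 0 0 (-(d • (gram F e TV TW)⁻¹)))) := by
  have hG : adelicGram F e TV TW = ratMatrix F (gram F e TV TW) := adelicGram_eq_map F e TV TW
  have hGi : (adelicGram F e TV TW)⁻¹ = ratMatrix F (gram F e TV TW)⁻¹ := by
    rw [hG, ratMatrix_inv F _ (isUnit_det_gram F e hVd hWd)]
  -- push the base change through `reindex`, `fromBlocks`, `-`, `•`
  have hC : ratMatrix F (Matrix.reindex finSumFinEquiv finSumFinEquiv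
        (Matrix.fromBlocks (gram F e TV TW) 0 0 (-(d • (gram F e TV TW)⁻¹)))) =
      Matrix.reindex finSumFinEquiv finSumFinEquiv
        (Matrix.fromBlocks (ratMatrix F (gram F e TV TW)) 0 0
          (-(algebraMap F (AdeleRing (𝓞 F) F) d • ratMatrix F (gram F e TV TW)⁻¹))) := by
    change (Matrix.reindex finSumFinEquiv finSumFinEquiv
        (Matrix.fromBlocks (gram F e TV TW) 0 0 (-(d • (gram F e TV TW)⁻¹)))).map (algebraMap F (AdeleRing (𝓞 F) F)) = _
    rw [Matrix.reindex_apply, Matrix.reindex_apply, ← Matrix.submatrix_map, Matrix.fromBlocks_map,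
      Matrix.map_neg _ (map_neg (algebraMap F (AdeleRing (𝓞 F) F))),
      Matrix.map_smul _ d (fun a => by rw [smul_eq_mul, map_mul, Algebra.smul_def]),
      Matrix.map_zero _ (map_zero (algebraMap F (AdeleRing (𝓞 F) F))), algebraMap_smul]
  have hblk : Matrix.fromBlocks ((⅟(2 : AdeleRing (𝓞 F) F) * b) • ratMatrix F (gram F e TV TW)) 0 0
        (-((⅟(2 : AdeleRing (𝓞 F) F) * (algebraMap F (AdeleRing (𝓞 F) F) d * b)) • ratMatrix F (gram F e TV TW)⁻¹)) =
      (⅟(2 : AdeleRing (𝓞 F) F) * b) • Matrix.fromBlocks (ratMatrix F (gram F e TV TW)) 0 0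
        (-(algebraMap F (AdeleRing (𝓞 F) F) d • ratMatrix F (gram F e TV TW)⁻¹)) := by
    rw [Matrix.fromBlocks_smul, smul_zero, smul_neg, smul_smul, show ⅟(2 : AdeleRing (𝓞 F) F) * b * algebraMap F (AdeleRing (𝓞 F) F) d =
      ⅟(2 : AdeleRing (𝓞 F) F) * (algebraMap F (AdeleRing (𝓞 F) F) d * b) by ring]
  rw [hC, hGi, hG, hblk]
  rfl

omit [Algebra.IsQuadraticExtension F E] in
/-- `½ · (t + t) = 1` for the Cayley entry `½t⁻¹·… `: `ι((2t)⁻¹) · (ι t + ι t) = 1` over `𝔸_E` (public form of the private lemma of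
★ `DoubledUnitaryRankOneReductionDiag`). [folklore] -/
theorem cayleyTwo_entry_mul' (hTW : TW 0 0 ≠ 0) :
    algebraMap E (AdeleRing (𝓞 E) E) (algebraMap F E (2 * TW 0 0)⁻¹) *
        (algebraMap E (AdeleRing (𝓞 E) E) (algebraMap F E (TW 0 0)) +
          algebraMap E (AdeleRing (𝓞 E) E) (algebraMap F E (TW 0 0))) = 1 := by
  rw [← map_add, ← map_add, ← map_mul, ← map_mul, ← two_mul, inv_mul_cancel₀ (mul_ne_zero two_ne_zero hTW), map_one, map_one]

/-- **The sum-model action of the unipotent element** `u = M·n(δ·y)·M⁻¹` through `jS`: Weil's unipotent shape with parameters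
`b = y·t`, `d` (★ A-p16 `toSp_adelicInr_cayley_conj_upper_apply` read through `hjS` and `reindexW`). [cite: Weil1965, n° 46 p. 66] -/
theorem sumModel_apply_sumElim_unip (hTW : TW 0 0 ≠ 0)
    (jS : ↥(UnitaryGroup.adelic F E c (1 + 1)
        ((Matrix.reindex finSumFinEquiv finSumFinEquiv (Matrix.fromBlocks TW 0 0 (-TW))).map (algebraMap F E))) →*
      ↥(symplecticGroup (polar (Matrix.toLinearMap₂' (AdeleRing (𝓞 F) F)
        (Matrix.fromBlocks (adelicGram F e TV TW) 0 0 (-adelicGram F e TV TW))))))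
    (hjS : ∀ (A : ↥(UnitaryGroup.adelic F E c (1 + 1)
        ((Matrix.reindex finSumFinEquiv finSumFinEquiv (Matrix.fromBlocks TW 0 0 (-TW))).map (algebraMap F E))))
        (v : (Fin (n + n) → AdeleRing (𝓞 F) F) × (Fin (n + n) → AdeleRing (𝓞 F) F)),
      ((spReindex (finSumFinEquiv : Fin n ⊕ Fin n ≃ Fin (n + n))
          (Matrix.fromBlocks (adelicGram F e TV TW) 0 0 (-adelicGram F e TV TW)) (jS A) :
          symplecticGroup (polar (Matrix.toLinearMap₂' (AdeleRing (𝓞 F) F)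
            (Matrix.reindex finSumFinEquiv finSumFinEquiv
              (Matrix.fromBlocks (adelicGram F e TV TW) 0 0 (-adelicGram F e TV TW)))))) :
        ((Fin (n + n) → AdeleRing (𝓞 F) F) × (Fin (n + n) → AdeleRing (𝓞 F) F)) ≃ₗ[AdeleRing (𝓞 F) F]
          ((Fin (n + n) → AdeleRing (𝓞 F) F) × (Fin (n + n) → AdeleRing (𝓞 F) F))) v =
      ((toSp F E c N (1 + 1)
          (((Equiv.prodCongr (Equiv.refl (Fin N)) finSumFinEquiv.symm).trans (Equiv.prodSumDistrib (Fin N) (Fin 1) (Fin 1))).trans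
            ((Equiv.sumCongr e e).trans finSumFinEquiv))
          (TV.map (algebraMap F E)) ((Matrix.reindex finSumFinEquiv finSumFinEquiv (Matrix.fromBlocks TW 0 0 (-TW))).map (algebraMap F E))
          hcδ hδ hd hV hW2 rfl rfl
          (adelicInr F E c N (1 + 1) (TV.map (algebraMap F E))
            ((Matrix.reindex finSumFinEquiv finSumFinEquiv (Matrix.fromBlocks TW 0 0 (-TW))).map (algebraMap F E)) A) :
          symplecticGroup (polar (adelicForm F (Fin (n + n))
            (adelicGram F
              (((Equiv.prodCongr (Equiv.refl (Fin N)) finSumFinEquiv.symm).trans (Equiv.prodSumDistrib (Fin N) (Fin 1) (Fin 1))).trans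
                ((Equiv.sumCongr e e).trans finSumFinEquiv)) TV
              (Matrix.reindex finSumFinEquiv finSumFinEquiv (Matrix.fromBlocks TW 0 0 (-TW))))))) :
        ((Fin (n + n) → AdeleRing (𝓞 F) F) × (Fin (n + n) → AdeleRing (𝓞 F) F)) ≃ₗ[AdeleRing (𝓞 F) F]
          ((Fin (n + n) → AdeleRing (𝓞 F) F) × (Fin (n + n) → AdeleRing (𝓞 F) F))) v)
    {M : GL (Fin 2) (AdeleRing (𝓞 E) E)}
    (hM : (M : Matrix (Fin 2) (Fin 2) (AdeleRing (𝓞 E) E)) =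
      !![1, algebraMap E (AdeleRing (𝓞 E) E) (algebraMap F E (2 * TW 0 0)⁻¹);
        1, -algebraMap E (AdeleRing (𝓞 E) E) (algebraMap F E (2 * TW 0 0)⁻¹)])
    {nx : GL (Fin 2) (AdeleRing (𝓞 E) E)} (y : AdeleRing (𝓞 F) F)
    (hn : (nx : Matrix (Fin 2) (Fin 2) (AdeleRing (𝓞 E) E)) = !![1, algebraMap E (AdeleRing (𝓞 E) E) δ * AdeleRing.baseChange F E y; 0, 1])
    (hA : M * nx * M⁻¹ ∈
      UnitaryGroup.adelic F E c (1 + 1) ((Matrix.reindex finSumFinEquiv finSumFinEquiv (Matrix.fromBlocks TW 0 0 (-TW))).map (algebraMap F E)))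
    (x₁ x₂ y₁ y₂ : Fin n → AdeleRing (𝓞 F) F) :
    ((jS ⟨M * nx * M⁻¹, hA⟩ :
        symplecticGroup (polar (Matrix.toLinearMap₂' (AdeleRing (𝓞 F) F)
          (Matrix.fromBlocks (adelicGram F e TV TW) 0 0 (-adelicGram F e TV TW))))) :
        ((Fin n ⊕ Fin n → AdeleRing (𝓞 F) F) × (Fin n ⊕ Fin n → AdeleRing (𝓞 F) F)) ≃ₗ[AdeleRing (𝓞 F) F]
          ((Fin n ⊕ Fin n → AdeleRing (𝓞 F) F) × (Fin n ⊕ Fin n → AdeleRing (𝓞 F) F))) (Sum.elim x₁ x₂, Sum.elim y₁ y₂) =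
      (Sum.elim (x₁ + (algebraMap F (AdeleRing (𝓞 F) F) d * (y * algebraMap F (AdeleRing (𝓞 F) F) (TW 0 0))) • (y₁ - y₂))
          (x₂ + (algebraMap F (AdeleRing (𝓞 F) F) d * (y * algebraMap F (AdeleRing (𝓞 F) F) (TW 0 0))) • (y₁ - y₂)),
        Sum.elim (y₁ + (y * algebraMap F (AdeleRing (𝓞 F) F) (TW 0 0)) • (x₁ - x₂))
          (y₂ + (y * algebraMap F (AdeleRing (𝓞 F) F) (TW 0 0)) • (x₁ - x₂))) := by
  have h := hjS ⟨M * nx * M⁻¹, hA⟩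
    (reindexW (AdeleRing (𝓞 F) F) (finSumFinEquiv : Fin n ⊕ Fin n ≃ Fin (n + n)) (Sum.elim x₁ x₂, Sum.elim y₁ y₂))
  rw [coe_spReindex_apply, LinearEquiv.symm_apply_apply,
    toSp_adelicInr_cayley_conj_upper_apply F E c hcδ hδ hd N e TW hV hW2 hTW hM y hn hA x₁ x₂ y₁ y₂] at h
  exact (reindexW (AdeleRing (𝓞 F) F) (finSumFinEquiv : Fin n ⊕ Fin n ≃ Fin (n + n))).injective h

set_option maxHeartbeats 400000 in
/-- **THE UNIPOTENT LIFTS OVER `j` (the binder `hLN` of the (S-1) dilate-bound file).**  For every adele `β` there are a Borel element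
`u ∈ U_D` and `q ∈ Mp_ψ(𝕎□_𝔸)ᶜᵒⁿᵗ` with `π q = j u`, `L(q) = 1` and `ω(q) = chirpLM (β • ratMatrix C₀)` (`C₀ = reindex (𝕋_F ⊕ −d 𝕋_F⁻¹)`), where
`j = conj(π u₀ · π(doublingDeltaLift)) ∘ spReindex ∘ jS` is the hom of record of ★ `H413E2SWBorelBoundFrame`.
[cite: Weil1964, Chap. I n° 13 p. 160] [cite: Weil1965, n° 46 p. 66] [cite: Li1992, p. 181] -/
theorem exists_lift_unipotent (hTW : TW 0 0 ≠ 0)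
    [MeasurableSpace (AdeleRing (𝓞 F) F)] [BorelSpace (AdeleRing (𝓞 F) F)]
    (ν : Measure (Fin (n + n) → AdeleRing (𝓞 F) F)) [ν.IsAddHaarMeasure]
    (u₀ : adelicMpCont F (Fin (n + n)) (doubledGramFin F (adelicGram F e TV TW)))
    (hu₀ : ∀ Ψ : piSchwartzBruhat F (Fin (n + n)),
      ((adelicMpCont.omega F (Fin (n + n)) (doubledGramFin F (adelicGram F e TV TW)) u₀ Ψ : piSchwartzBruhat F (Fin (n + n))) :
          (Fin (n + n) → AdeleRing (𝓞 F) F) → ℂ) =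
        chirp F (ratMatrix F (frameHalfRat F)) (Ψ : (Fin (n + n) → AdeleRing (𝓞 F) F) → ℂ))
    (jS : ↥(UnitaryGroup.adelic F E c (1 + 1)
        ((Matrix.reindex finSumFinEquiv finSumFinEquiv (Matrix.fromBlocks TW 0 0 (-TW))).map (algebraMap F E))) →*
      ↥(symplecticGroup (polar (Matrix.toLinearMap₂' (AdeleRing (𝓞 F) F)
        (Matrix.fromBlocks (adelicGram F e TV TW) 0 0 (-adelicGram F e TV TW))))))
    (hjS : ∀ (A : ↥(UnitaryGroup.adelic F E c (1 + 1)
        ((Matrix.reindex finSumFinEquiv finSumFinEquiv (Matrix.fromBlocks TW 0 0 (-TW))).map (algebraMap F E))))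
        (v : (Fin (n + n) → AdeleRing (𝓞 F) F) × (Fin (n + n) → AdeleRing (𝓞 F) F)),
      ((spReindex (finSumFinEquiv : Fin n ⊕ Fin n ≃ Fin (n + n))
          (Matrix.fromBlocks (adelicGram F e TV TW) 0 0 (-adelicGram F e TV TW)) (jS A) :
          symplecticGroup (polar (Matrix.toLinearMap₂' (AdeleRing (𝓞 F) F)
            (Matrix.reindex finSumFinEquiv finSumFinEquiv
              (Matrix.fromBlocks (adelicGram F e TV TW) 0 0 (-adelicGram F e TV TW)))))) :
        ((Fin (n + n) → AdeleRing (𝓞 F) F) × (Fin (n + n) → AdeleRing (𝓞 F) F)) ≃ₗ[AdeleRing (𝓞 F) F]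
          ((Fin (n + n) → AdeleRing (𝓞 F) F) × (Fin (n + n) → AdeleRing (𝓞 F) F))) v =
      ((toSp F E c N (1 + 1)
          (((Equiv.prodCongr (Equiv.refl (Fin N)) finSumFinEquiv.symm).trans (Equiv.prodSumDistrib (Fin N) (Fin 1) (Fin 1))).trans
            ((Equiv.sumCongr e e).trans finSumFinEquiv))
          (TV.map (algebraMap F E)) ((Matrix.reindex finSumFinEquiv finSumFinEquiv (Matrix.fromBlocks TW 0 0 (-TW))).map (algebraMap F E))
          hcδ hδ hd hV hW2 rfl rfl
          (adelicInr F E c N (1 + 1) (TV.map (algebraMap F E))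
            ((Matrix.reindex finSumFinEquiv finSumFinEquiv (Matrix.fromBlocks TW 0 0 (-TW))).map (algebraMap F E)) A) :
          symplecticGroup (polar (adelicForm F (Fin (n + n))
            (adelicGram F
              (((Equiv.prodCongr (Equiv.refl (Fin N)) finSumFinEquiv.symm).trans (Equiv.prodSumDistrib (Fin N) (Fin 1) (Fin 1))).trans
                ((Equiv.sumCongr e e).trans finSumFinEquiv)) TV
              (Matrix.reindex finSumFinEquiv finSumFinEquiv (Matrix.fromBlocks TW 0 0 (-TW))))))) :
        ((Fin (n + n) → AdeleRing (𝓞 F) F) × (Fin (n + n) → AdeleRing (𝓞 F) F)) ≃ₗ[AdeleRing (𝓞 F) F]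
          ((Fin (n + n) → AdeleRing (𝓞 F) F) × (Fin (n + n) → AdeleRing (𝓞 F) F))) v)
    (j : ↥(UnitaryGroup.adelic F E c (1 + 1)
        ((Matrix.reindex finSumFinEquiv finSumFinEquiv (Matrix.fromBlocks TW 0 0 (-TW))).map (algebraMap F E))) →*
      ↥(symplecticGroup (polar (adelicForm F (Fin (n + n)) (doubledGramFin F (adelicGram F e TV TW))))))
    (hj : j = (MulAut.conj (adelicMpCont.proj F (Fin (n + n)) (doubledGramFin F (adelicGram F e TV TW)) u₀ *
        adelicMpCont.proj F (Fin (n + n)) (doubledGramFin F (adelicGram F e TV TW))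
          (doublingDeltaLift F (adelicGram F e TV TW) (isUnit_det_adelicGram F e hVd hWd)))).toMonoidHom.comp
      ((spReindex (finSumFinEquiv : Fin n ⊕ Fin n ≃ Fin (n + n))
        (Matrix.fromBlocks (adelicGram F e TV TW) 0 0 (-adelicGram F e TV TW))).comp jS))
    (β : AdeleRing (𝓞 F) F) :
    ∃ (q : adelicMpCont F (Fin (n + n)) (doubledGramFin F (adelicGram F e TV TW))) (u : GL (Fin (1 + 1)) (AdeleRing (𝓞 E) E))
      (hu : u ∈ UnitaryGroup.adelic F E c (1 + 1)
        ((Matrix.reindex finSumFinEquiv finSumFinEquiv (Matrix.fromBlocks TW 0 0 (-TW))).map (algebraMap F E))),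
      (u : Matrix (Fin (1 + 1)) (Fin (1 + 1)) (AdeleRing (𝓞 E) E)) 0 0 + (u : Matrix (Fin (1 + 1)) (Fin (1 + 1)) (AdeleRing (𝓞 E) E)) 0 1 =
        (u : Matrix (Fin (1 + 1)) (Fin (1 + 1)) (AdeleRing (𝓞 E) E)) 1 0 + (u : Matrix (Fin (1 + 1)) (Fin (1 + 1)) (AdeleRing (𝓞 E) E)) 1 1 ∧
      adelicMpCont.proj F (Fin (n + n)) (doubledGramFin F (adelicGram F e TV TW)) q = j ⟨u, hu⟩ ∧
      adelicMpCont.l2Scaling F (doubledGramFin F (adelicGram F e TV TW))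
          (isUnit_det_doubledGramFin F (adelicGram F e TV TW) (isUnit_det_adelicGram F e hVd hWd)) ν q = 1 ∧
      ∀ Ψ : piSchwartzBruhat F (Fin (n + n)),
        adelicMpCont.omega F (Fin (n + n)) (doubledGramFin F (adelicGram F e TV TW)) q Ψ =
          chirpLM F (β • ratMatrix F (Matrix.reindex finSumFinEquiv finSumFinEquiv
            (Matrix.fromBlocks (gram F e TV TW) 0 0 (-(d • (gram F e TV TW)⁻¹))))) Ψ := by
  -- the parameter `y = −2β/t`, so that the unipotent-shape parameter of `u⁻¹` is `b' = (−y)·t = 2β` and `½ b' = β`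
  have hy : ⅟(2 : AdeleRing (𝓞 F) F) * (-(-(2 * β * algebraMap F (AdeleRing (𝓞 F) F) (TW 0 0)⁻¹)) *
      algebraMap F (AdeleRing (𝓞 F) F) (TW 0 0)) = β := by
    rw [neg_neg, mul_assoc, ← map_mul, inv_mul_cancel₀ hTW, map_one, mul_one, ← mul_assoc, invOf_mul_self', one_mul]
  -- the unipotent `nx = n(δ·y)`, `y = −2β/t`, its inverse `n(δ·(−y))`, and `u = M nx M⁻¹ ∈ U_D`
  have hex := exists_upper (algebraMap E (AdeleRing (𝓞 E) E) δ *
    AdeleRing.baseChange F E (-(2 * β * algebraMap F (AdeleRing (𝓞 F) F) (TW 0 0)⁻¹)))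
  obtain ⟨nx, hn, hninv⟩ := hex
  have hninv' : ((nx⁻¹ : GL (Fin 2) (AdeleRing (𝓞 E) E)) : Matrix (Fin 2) (Fin 2) (AdeleRing (𝓞 E) E)) =
      !![1, algebraMap E (AdeleRing (𝓞 E) E) δ * AdeleRing.baseChange F E (-(-(2 * β * algebraMap F (AdeleRing (𝓞 F) F) (TW 0 0)⁻¹))); 0, 1] := by
    rw [hninv]
    simp only [map_neg, mul_neg, neg_neg]
  have hexM := exists_cayleyTwo F E TW hTW
  obtain ⟨M, -, hM⟩ := hexM
  have hu : M * nx * M⁻¹ ∈ UnitaryGroup.adelic F E c (1 + 1)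
      ((Matrix.reindex finSumFinEquiv finSumFinEquiv (Matrix.fromBlocks TW 0 0 (-TW))).map (algebraMap F E)) :=
    cayley_conj_upper_mem_adelic F E c TW hTW hM hn (conjAdele_delta_mul_baseChange_add F E c δ hcδ (-(2 * β * algebraMap F (AdeleRing (𝓞 F) F) (TW 0 0)⁻¹)))
  have hu' : M * nx⁻¹ * M⁻¹ ∈ UnitaryGroup.adelic F E c (1 + 1)
      ((Matrix.reindex finSumFinEquiv finSumFinEquiv (Matrix.fromBlocks TW 0 0 (-TW))).map (algebraMap F E)) :=
    cayley_conj_upper_mem_adelic F E c TW hTW hM hninv' (conjAdele_delta_mul_baseChange_add F E c δ hcδ (-(-(2 * β * algebraMap F (AdeleRing (𝓞 F) F) (TW 0 0)⁻¹))))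
  have hrow := rowSum_cayley_conj_upper hM (cayleyTwo_entry_mul' F E TW hTW) hn
  -- sum-model actions of `u` and `u⁻¹` (unipotent shapes with parameters `y·t`, `(−y)·t`)
  have hgv := sumModel_apply_sumElim_unip F E c hcδ hδ hd N e TW hV hW2 hTW jS hjS hM (-(2 * β * algebraMap F (AdeleRing (𝓞 F) F) (TW 0 0)⁻¹)) hn hu
  have hAinv : (⟨M * nx * M⁻¹, hu⟩ : ↥(UnitaryGroup.adelic F E c (1 + 1)
      ((Matrix.reindex finSumFinEquiv finSumFinEquiv (Matrix.fromBlocks TW 0 0 (-TW))).map (algebraMap F E))))⁻¹ =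
      ⟨M * nx⁻¹ * M⁻¹, hu'⟩ :=
    Subtype.ext (by
      change (M * nx * M⁻¹)⁻¹ = M * nx⁻¹ * M⁻¹
      rw [_root_.mul_inv_rev, _root_.mul_inv_rev, inv_inv, mul_assoc])
  have hgv' : ∀ x₁ x₂ y₁ y₂ : Fin n → AdeleRing (𝓞 F) F,
      ((jS ⟨M * nx * M⁻¹, hu⟩ :
          symplecticGroup (polar (Matrix.toLinearMap₂' (AdeleRing (𝓞 F) F)
            (Matrix.fromBlocks (adelicGram F e TV TW) 0 0 (-adelicGram F e TV TW))))) :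
          ((Fin n ⊕ Fin n → AdeleRing (𝓞 F) F) × (Fin n ⊕ Fin n → AdeleRing (𝓞 F) F)) ≃ₗ[AdeleRing (𝓞 F) F]
            ((Fin n ⊕ Fin n → AdeleRing (𝓞 F) F) × (Fin n ⊕ Fin n → AdeleRing (𝓞 F) F))).symm (Sum.elim x₁ x₂, Sum.elim y₁ y₂) =
        (Sum.elim (x₁ + (algebraMap F (AdeleRing (𝓞 F) F) d * (-(-(2 * β * algebraMap F (AdeleRing (𝓞 F) F) (TW 0 0)⁻¹)) * algebraMap F (AdeleRing (𝓞 F) F) (TW 0 0))) • (y₁ - y₂))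
            (x₂ + (algebraMap F (AdeleRing (𝓞 F) F) d * (-(-(2 * β * algebraMap F (AdeleRing (𝓞 F) F) (TW 0 0)⁻¹)) * algebraMap F (AdeleRing (𝓞 F) F) (TW 0 0))) • (y₁ - y₂)),
          Sum.elim (y₁ + (-(-(2 * β * algebraMap F (AdeleRing (𝓞 F) F) (TW 0 0)⁻¹)) * algebraMap F (AdeleRing (𝓞 F) F) (TW 0 0)) • (x₁ - x₂))
            (y₂ + (-(-(2 * β * algebraMap F (AdeleRing (𝓞 F) F) (TW 0 0)⁻¹)) * algebraMap F (AdeleRing (𝓞 F) F) (TW 0 0)) • (x₁ - x₂))) := by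
    intro x₁ x₂ y₁ y₂
    have hsymm : ((jS ⟨M * nx * M⁻¹, hu⟩ :
          symplecticGroup (polar (Matrix.toLinearMap₂' (AdeleRing (𝓞 F) F)
            (Matrix.fromBlocks (adelicGram F e TV TW) 0 0 (-adelicGram F e TV TW))))) :
          ((Fin n ⊕ Fin n → AdeleRing (𝓞 F) F) × (Fin n ⊕ Fin n → AdeleRing (𝓞 F) F)) ≃ₗ[AdeleRing (𝓞 F) F]
            ((Fin n ⊕ Fin n → AdeleRing (𝓞 F) F) × (Fin n ⊕ Fin n → AdeleRing (𝓞 F) F))).symm =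
        ((jS ⟨M * nx⁻¹ * M⁻¹, hu'⟩ :
          symplecticGroup (polar (Matrix.toLinearMap₂' (AdeleRing (𝓞 F) F)
            (Matrix.fromBlocks (adelicGram F e TV TW) 0 0 (-adelicGram F e TV TW))))) :
          ((Fin n ⊕ Fin n → AdeleRing (𝓞 F) F) × (Fin n ⊕ Fin n → AdeleRing (𝓞 F) F)) ≃ₗ[AdeleRing (𝓞 F) F]
            ((Fin n ⊕ Fin n → AdeleRing (𝓞 F) F) × (Fin n ⊕ Fin n → AdeleRing (𝓞 F) F))) := by
      rw [← hAinv, map_inv]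
      rfl
    rw [hsymm]
    exact sumModel_apply_sumElim_unip F E c hcδ hδ hd N e TW hV hW2 hTW jS hjS hM (-(-(2 * β * algebraMap F (AdeleRing (𝓞 F) F) (TW 0 0)⁻¹))) hninv' hu' x₁ x₂ y₁ y₂
  -- `g ∈ Stab(W^Δ)`, the parabolic element and the frame lift
  have hg : jS ⟨M * nx * M⁻¹, hu⟩ ∈ stabDiag (adelicGram F e TV TW) := mem_stabDiag_of_unipShape (adelicGram F e TV TW) _ hgv
  have hP := coe_stabDiagParabolicFin F (adelicGram F e TV TW) (isUnit_det_adelicGram F e hVd hWd) ⟨_, hg⟩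
  have hω : ∀ Ψ : piSchwartzBruhat F (Fin (n + n)),
      adelicMpCont.omega F (Fin (n + n)) (doubledGramFin F (adelicGram F e TV TW))
        (u₀ * adelicSiegelLiftCont F (doubledGramFin F (adelicGram F e TV TW))
          (isUnit_det_doubledGramFin F (adelicGram F e TV TW) (isUnit_det_adelicGram F e hVd hWd))
          (stabDiagParabolicFin F (adelicGram F e TV TW) (isUnit_det_adelicGram F e hVd hWd) ⟨_, hg⟩) * u₀⁻¹) Ψ =
      chirpLM F (β • ratMatrix F (Matrix.reindex finSumFinEquiv finSumFinEquiv
        (Matrix.fromBlocks (gram F e TV TW) 0 0 (-(d • (gram F e TV TW)⁻¹))))) Ψ := by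
    intro Ψ
    have h := omega_conj_adelicSiegelLiftCont_of_unipShape F (adelicGram F e TV TW) (isUnit_det_adelicGram F e hVd hWd)
      (g := jS ⟨M * nx * M⁻¹, hu⟩)
      (P := stabDiagParabolicFin F (adelicGram F e TV TW) (isUnit_det_adelicGram F e hVd hWd) ⟨_, hg⟩)
      (u₀ := u₀) (hu₀ := hu₀) (hP := hP) (hN' := hgv') Ψ
    exact h.trans (congrArg (fun S : Matrix (Fin (n + n)) (Fin (n + n)) (AdeleRing (𝓞 F) F) => chirpLM F S Ψ)
      ((unipChirpMatrix_eq_smul_ratMatrix_C0 F N e TW hVd hWd _).trans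
        (congrArg (· • ratMatrix F (Matrix.reindex finSumFinEquiv finSumFinEquiv
          (Matrix.fromBlocks (gram F e TV TW) 0 0 (-(d • (gram F e TV TW)⁻¹))))) hy)))
  refine ⟨u₀ * adelicSiegelLiftCont F (doubledGramFin F (adelicGram F e TV TW))
      (isUnit_det_doubledGramFin F (adelicGram F e TV TW) (isUnit_det_adelicGram F e hVd hWd))
      (stabDiagParabolicFin F (adelicGram F e TV TW) (isUnit_det_adelicGram F e hVd hWd) ⟨_, hg⟩) * u₀⁻¹,
    M * nx * M⁻¹, hu, hrow, ?_, ?_, hω⟩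
  · rw [hj]
    exact proj_frameLift_eq F (adelicGram F e TV TW) (isUnit_det_adelicGram F e hVd hWd) u₀ _ hg
  · -- isometric: a pure chirp (trivial twist)
    have hL := adelicMpCont.l2Scaling_of_omega_eq_chirpLM_twistLM F (doubledGramFin F (adelicGram F e TV TW))
      (isUnit_det_doubledGramFin F (adelicGram F e TV TW) (isUnit_det_adelicGram F e hVd hWd)) ν _
      (β • ratMatrix F (Matrix.reindex finSumFinEquiv finSumFinEquiv
        (Matrix.fromBlocks (gram F e TV TW) 0 0 (-(d • (gram F e TV TW)⁻¹))))) 1 (fun Φ => by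
        rw [twistLM_one]
        exact hω Φ)
    rw [hL, inv_one, map_one, ENNReal.coe_one]

end Summit.HodgeConjecture.HodgeConjecture.Cruxes.H413.E2SWBorelBoundFrameUnip

end
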